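import Summits.CriticalPhenomena.PercolationContinuityZ3.Theorems.Transplant.GrigorchukWitnessConj4Defs
import Mathlib.Algebra.Group.Subgroup.Finite
import HarnessLib

/-!
# Conjecture 4 ON THE CANDIDATE THIRD FAMILY W4 = `Cay(𝔊^k; standard generators)` — the direct powers of the first Grigorchuk group — as a NAMED
# STATEMENT (`@[conjecture]`, NOT asserted), with its derivation from Conjecture 4 (kernel scope facts) and from the residue node (growth carried)

Definitions file (`--supports stmt-CriticalPhenomena-4575`), lane `prim-bschramm`, seat `prim-bschramm-gen-1` gen 11 (GEN pen); typed under director-frontier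
g15's ruling #9030 (b)(1) and lead g28's RULING #9067 (statement-first, the p653422 pattern of «GrigorchukWitnessConj4Defs»).  builds on p205010 (kernel theorem,
internal audit signed; external expert review pending) — nothing in this file uses p205010.  No instance, no notation, no sorry; ONE statement recorded
`@[conjecture]` (NOT asserted) and its derivations from existing nodes proved; the nodes are HYPOTHESES, never asserted.

CONTEXT.  The [W] ideation round's door D7 (operator-infrared / lace line, w-idea-1 CARD-4) located its gap on `𝔊` itself; the design desk (p3 g41 #9024) and the
director (#9030 (b)) ADMITTED as a CANDIDATE third family W4 = the Cayley graphs of the direct powers `𝔊^k` on the 4k STANDARD generators (the letters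
`a, b, c, d` in each coordinate): a residue-node instance by product scope (`𝔊^k` amenable, of intermediate growth — Grigorchuk 1984, cited as
print: finite direct powers of a group of intermediate growth have intermediate growth), with the coordinate symmetric group `S_k ≤ Aut` and a small
parameter `β_k = O(1/k)`.  W4 is a CANDIDATE only: it is certified as a witness family only
on a round-2 PASS (W-ROUND-2.md §3); nothing is claimed about it here beyond the kernel scope facts below.

CONTENT (`Grigorchuk.GPow k = Fin k → 𝔊`, `Grigorchuk.gkGens k` = `{Pi.mulSingle i y : i < k, y ∈ {a,b,c,d}}`, `Grigorchuk.gkCay k = mulCayley ↑(gkGens k)`):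
* `Grigorchuk.gkCay_conj4 k : Prop := ∀ v, theta (gkCay k) v (criticalProbIOf (gkCay k) v) = 0` — `θ_v(p_c) = 0` at every vertex of `Cay(𝔊^k; std)`
  (`@[conjecture]`, NOT asserted; binder shape = `stdCay_conj4` / `gzCay_conj4` of p653422).
* SCOPE FACTS, KERNEL: `closure_gkGens` (the standard generators generate `𝔊^k`: Mathlib `Subgroup.pi_le_iff` over «GrigorchukCriticalProbLtOne»
  `closure_gens_finset`), `gkCay_connected`, `gkCay_isQuasiTransitive`, **`gkCay_criticalProb_lt_one (hk : 1 ≤ k)`** (`𝔊 ↪ 𝔊^k` along the first coordinate;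
  Muchnik–Pak transfers along injective homomorphisms, p607347 `criticalProb_lt_one_of_grigorchukGroup_hom`), and
  `gkCay_isGraphAmenable_of_not_hasExponentialGrowth` (Lyons–Peres §6.1 contrapositive).
* SCOPE FACT, CARRIED (lead g28 #9067: not a ≤ 40-line customer of existing files tonight): `¬ HasExponentialGrowth (gkCay k)`.
  -- TODO(later pen, ≈ 80 l.): the coordinate projections `𝔊^k → 𝔊` are contractions of `gkCay k` onto `stdCay`, so `B(1, n) ⊆ ∏_i B_𝔊(1, n)` and
  -- `|B(1, n)| ≤ |B_𝔊(1, n)|^k`; exponential growth `c^n ≤ |B(1, n)|` would give `(c^{1/k})^n ≤ |B_𝔊(1, n)|`, against p613200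
  -- `not_hasExponentialGrowth_cayley_gens`.  (Equivalently: `gkCay k` is the `k`-fold box power of `stdCay`.)
* CUSTOMERS: **`gkCay_conj4_of_conj4 (hk : 1 ≤ k) : BenjaminiSchramm1996_conj4 → gkCay_conj4 k`** (Conjecture 4 needs only connected + quasi-transitive +
  `p_c < 1` — all kernel: NO carried hypothesis); `gkCay_conj4_of_conj4_amenableSubexponential (hk) (hgr : ¬ HasExponentialGrowth (gkCay k))` (the residue node's
  derivation, growth CARRIED); `gkCay_conj4_iff (hk)` (the lane's `p_c < 1 ∧ θ(p_c) = 0` package, first conjunct kernel).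
`k = 0` is the one-vertex graph (no generators; `p_c` is a junk value there) — every customer takes `1 ≤ k`; `k = 1` is `Cay(𝔊; a,b,c,d)` up to the
isomorphism `Fin 1 → 𝔊 ≃ 𝔊` (not recorded).  STATUS: `θ(p_c) = 0` on `Cay(𝔊^k; std)` is NOT PROVED for any `k`, in the tree or in print; the residue node,
`stdCay_conj4`, `gzCay_conj4`, `BenjaminiSchramm1996_conj4_endState` and Conjecture 4 stay OPEN; nothing here bears on their truth.
[cite: BenjaminiSchramm1996, Conj. 4] [cite: Grigorchuk1984, Thm.] [cite: MuchnikPak2001, Thm. 1] [cite: LyonsPeres2016, §6.1]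
-/

noncomputable section

namespace Summit.CriticalPhenomena.PercolationContinuityZ3.Theorems.Transplant

namespace Grigorchuk

open SimpleGraph Literature.Barriers.CriticalPhenomena Literature.Probability.Percolation Literature.Probability.LatticeModels
open scoped Classical

/-! ### §1 The group `𝔊^k`, its standard generators, the graph -/

/-- The direct power `𝔊^k = Fin k → 𝔊` of the first Grigorchuk group (pointwise group structure). [cite: Grigorchuk1984, Thm. (𝔊; direct powers)] -/
abbrev GPow (k : ℕ) : Type := Fin k → ↥grigorchukGroup

/-- **The 4k standard generators of `𝔊^k`**: the letters `a, b, c, d` placed in one coordinate, `Pi.mulSingle i y` (`i < k`, `y ∈ {a, b, c, d}`).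
[cite: BenjaminiSchramm1996, §2 (Cayley graphs)] [cite: Grigorchuk1980, definition of a, b, c, d] -/
def gkGens (k : ℕ) : Finset (GPow k) :=
  ((Finset.univ : Finset (Fin k)) ×ˢ ({aG, bG, cG, dG} : Finset ↥grigorchukGroup)).image fun p => Pi.mulSingle p.1 p.2

/-- **W4's graph `Cay(𝔊^k; standard generators)`**: the RIGHT Cayley graph of `𝔊^k` on `gkGens k` (`u — u·y` for `y` a letter in one coordinate; as a graph the
`k`-fold box power of `Cay(𝔊; a,b,c,d)`); an `abbrev`, so the tree's `LocallyFinite` instance for `mulCayley` of a finite set is found through it.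
[cite: BenjaminiSchramm1996, §2 (Cayley graphs)] -/
abbrev gkCay (k : ℕ) : SimpleGraph (GPow k) := mulCayley (↑(gkGens k) : Set (GPow k))

/-- A letter in coordinate `i` is a standard generator. [folklore] -/
theorem mulSingle_mem_gkGens {k : ℕ} (i : Fin k) {y : ↥grigorchukGroup} (hy : y ∈ ({aG, bG, cG, dG} : Finset ↥grigorchukGroup)) :
    Pi.mulSingle i y ∈ gkGens k :=
  Finset.mem_image.2 ⟨(i, y), Finset.mem_product.2 ⟨Finset.mem_univ _, hy⟩, rfl⟩

/-! ### §2 The W4 statement (NOT asserted) -/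

/-- **Conjecture node (NOT asserted): `θ_v(p_c) = 0` at every vertex of `Cay(𝔊^k; standard generators)`** — Benjamini–Schramm's Conjecture 4 for the direct
powers of the first Grigorchuk group, the [W] round's ADMITTED CANDIDATE third family W4 (director-frontier g15 #9030 (b); design desk p3 g41 #9024): `𝔊^k` is
amenable and of intermediate growth (Grigorchuk 1984 — cited as print: direct powers of a group of intermediate growth; no exponent typed), `p_c < 1` for `k ≥ 1` (kernel below), the
coordinate symmetric group `S_k` acts by automorphisms; certified as a witness family only on a round-2 PASS; NOT PROVED in tree or print for any `k`; nothing
claimed.  (`k = 0`: the one-vertex graph, vacuous/junk; customers take `1 ≤ k`.) [cite: BenjaminiSchramm1996, Conj. 4] [cite: Grigorchuk1984, Thm.] -/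
@[conjecture] def gkCay_conj4 (k : ℕ) : Prop :=
  ∀ v : GPow k, theta (gkCay k) v (criticalProbIOf (gkCay k) v) = 0

/-! ### §3 The scope facts that are kernel: generation, connectedness, quasi-transitivity, `p_c < 1`, amenability given subexponential growth -/

/-- **The standard generators generate `𝔊^k`** (coordinatewise: `{a,b,c,d}` generates `𝔊`, «GrigorchukCriticalProbLtOne» `closure_gens_finset`; a finite direct
power is generated by the coordinate embeddings, Mathlib `Subgroup.pi_le_iff`). [cite: Grigorchuk1980, 𝔊 = ⟨a, b, c, d⟩] -/
theorem closure_gkGens (k : ℕ) : Subgroup.closure (↑(gkGens k) : Set (GPow k)) = ⊤ := by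
  rw [eq_top_iff, ← Subgroup.pi_top (Set.univ : Set (Fin k)), Subgroup.pi_le_iff]
  intro i
  rw [← closure_gens_finset, MonoidHom.map_closure]
  refine Subgroup.closure_mono ?_
  rintro _ ⟨s, hs, rfl⟩
  exact Finset.mem_coe.2 (mulSingle_mem_gkGens i (Finset.mem_coe.1 hs))

/-- `Cay(𝔊^k; std)` is connected. [cite: BenjaminiSchramm1996, §2 (Cayley graphs)] -/
theorem gkCay_connected (k : ℕ) : (gkCay k).Connected := CayleyScaled.connected_mulCayley_of_closure (gkGens k) (closure_gkGens k)

/-- `Cay(𝔊^k; std)` is quasi-transitive (indeed vertex-transitive, by left multiplications). [cite: BenjaminiSchramm1996, §2 (Cayley graphs)] -/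
theorem gkCay_isQuasiTransitive (k : ℕ) : IsQuasiTransitive (gkCay k) := CayleyScaled.isQuasiTransitive_mulCayley (gkGens k)

/-- **`p_c(Cay(𝔊^k; std)) < 1` at every vertex, for `k ≥ 1` — kernel**: `𝔊` embeds into `𝔊^k` along the first coordinate (`MonoidHom.mulSingle`), and
`p_c < 1` transfers from `𝔊` along injective homomorphisms (p607347 `criticalProb_lt_one_of_grigorchukGroup_hom`, Muchnik–Pak kernel). [cite: MuchnikPak2001, Thm. 1] -/
theorem gkCay_criticalProb_lt_one {k : ℕ} (hk : 1 ≤ k) (v : GPow k) : criticalProb (gkCay k) v < 1 :=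
  criticalProb_lt_one_of_grigorchukGroup_hom (gkGens k) (closure_gkGens k)
    (MonoidHom.mulSingle (fun _ : Fin k => ↥grigorchukGroup) ⟨0, hk⟩)
    (fun _ _ h => Pi.mulSingle_injective (M := fun _ : Fin k => ↥grigorchukGroup) (⟨0, hk⟩ : Fin k) h) v

/-- **Amenability of `Cay(𝔊^k; std)` GIVEN subexponential growth** (a nonamenable quasi-transitive graph grows exponentially, Lyons–Peres §6.1; the growth input is
CARRIED here, see the module docstring's TODO). [cite: LyonsPeres2016, §6.1 (p. 279)] -/
theorem gkCay_isGraphAmenable_of_not_hasExponentialGrowth {k : ℕ} (hgr : ¬ HasExponentialGrowth (gkCay k)) : IsGraphAmenable (gkCay k) := by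
  by_contra hna
  exact hgr (hasExponentialGrowth_of_not_isGraphAmenable _ (gkCay_isQuasiTransitive k) hna)

/-! ### §4 Derivations from the existing nodes (the nodes are HYPOTHESES, never asserted) -/

/-- **Conjecture 4 implies `gkCay_conj4 k` for every `k ≥ 1`** — Conjecture 4 asks only connected + quasi-transitive + `p_c < 1`, all KERNEL for `Cay(𝔊^k; std)`
(§3); no carried hypothesis. [cite: BenjaminiSchramm1996, Conj. 4] -/
theorem gkCay_conj4_of_conj4 {k : ℕ} (hk : 1 ≤ k) (h : BenjaminiSchramm1996_conj4) : gkCay_conj4 k :=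
  fun v => h (gkCay k) (gkCay_connected k) (gkCay_isQuasiTransitive k) v (gkCay_criticalProb_lt_one hk v)

/-- **The residue node implies `gkCay_conj4 k` for `k ≥ 1`, GIVEN subexponential growth of `Cay(𝔊^k; std)`** (the growth fact is CARRIED as `hgr` — true in
print: `𝔊^k` has intermediate growth since `𝔊` does, Grigorchuk 1984; not typed tonight, TODO in the module docstring); amenability then follows (§3).
[cite: BenjaminiSchramm1996, Conj. 4] [cite: Grigorchuk1984, Thm. (upper bound)] -/
theorem gkCay_conj4_of_conj4_amenableSubexponential {k : ℕ} (hk : 1 ≤ k) (hgr : ¬ HasExponentialGrowth (gkCay k))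
    (h : BenjaminiSchramm1996_conj4_amenableSubexponential) : gkCay_conj4 k :=
  fun v => h (gkCay k) (gkCay_connected k) (gkCay_isQuasiTransitive k) (gkCay_isGraphAmenable_of_not_hasExponentialGrowth hgr) hgr v
    (gkCay_criticalProb_lt_one hk v)

/-- `gkCay_conj4 k` as the conjunction package `p_c < 1 ∧ θ(p_c) = 0` at every vertex (`k ≥ 1`) — the first conjunct is KERNEL (§3), so the node is exactly the
missing second conjunct; an honest equivalence, no new content. [cite: BenjaminiSchramm1996, Conj. 4] [cite: MuchnikPak2001, Thm. 1] -/
theorem gkCay_conj4_iff {k : ℕ} (hk : 1 ≤ k) :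
    gkCay_conj4 k ↔ ∀ v : GPow k, criticalProb (gkCay k) v < 1 ∧ theta (gkCay k) v (criticalProbIOf (gkCay k) v) = 0 :=
  ⟨fun h v => ⟨gkCay_criticalProb_lt_one hk v, h v⟩, fun h v => (h v).2⟩

end Grigorchuk

end Summit.CriticalPhenomena.PercolationContinuityZ3.Theorems.Transplant
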